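import Summits.ValiantsHypothesis.ValiantsHypothesis.Theorems.FeketeSOSFeketeSOSHardPaleyRIPHalfSpectrum
import Summits.ValiantsHypothesis.ValiantsHypothesis.Theorems.FeketeSOSFeketeSOSHardPaleyRIPSpectralFloors

/-!
# Route FeketeSOS — crux `FeketeSOSHard` (stmt-ValiantsHypothesis-3996), line `paley-rip` v3:
# rank-two operator tameness from small-density anti-concentration alone, on supports of bounded sum multiplicity

The registered stub `stub_tameOperator` (`Cruxes/FeketeSOSHard/Lines/paley_rip_v3.lean`) at `r = 2` is product
tameness (census `Cruxes/FeketeSOSHard/Lines/paley-rip-stub3-census.md` §4).  Parts 1–3 of this series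
(`…PaleyRIPHalfSpectrumFloor`, `…PaleyRIPHalfSpectrum`, `…PaleyRIPSpectralFloors`) put the census mechanism
§6 (W1)–(W3) in kernel form.  This file assembles the asymmetric version in the line's vocabulary:

* `tameOperator_rank_two_of_antiConcentration` — let `S ⊆ [0,p)` have SUM MULTIPLICITY `≤ g` modulo `p` (every
  residue has at most `g` ordered representations `s + t`, `s, t ∈ S`; `g = 2` for Sidon sets) and the
  ANTI-CONCENTRATION FLOOR `e₁ ∈ (0,1)` at a density `σ` with `√(gσ) ≤ 1/2`: every `w` supported in `S` keeps at
  least `e₁` of its spectral energy `Σ_k |ŵ(k)|²` on every set of `≥ σp` frequencies (equivalently: the set where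
  `|ŵ|²` is below `e₁/σ` times its mean has fewer than `σp` elements — census `α_S`).  Then every pair of weighted
  squares supported in `S` with cyclic pattern `F`, `|F_n| ≤ M`, is re-represented by squares supported in `S` of
  mass `≤ (2#S/e₁)·M`: `stub_tameOperator` at `r = 2`, exponent `1`, constant `2/e₁`.

The concentration half of the mechanism is supplied unconditionally by `dft_energy_floor_of_sumMultiplicity`
(`Λ(4) ≤ g`), so on such supports the census programme (W5a) is reduced to ONE input, the small-density floor.
Status of that input: on `𝕋` it is a theorem for spectra of bounded difference multiplicity — Zygmund (1948),
made uniform in the set by Nazarov (Algebra i Analiz 5:4 (1993); constant `exp(D(ε,R)/m(E)^{2+ε})`, see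
Nazarov–Nishry–Sodin, arXiv:1310.7542, §1.3); the `ℤ/p` version needed here is OPEN, and bounded multiplicity
forces `#S ≲ √(gp)` (the sub-`√p` world).  Honest framing: conditional rung; nothing here proves the stub, the
engine `stub_paleyFlatRIP`, the crux, or anything about `VP ≠ VNP`.
-/

set_option linter.dupNamespace false

namespace Summit.ValiantsHypothesis.ValiantsHypothesis.Theorems.FeketeSOSHardPaleyRIP

open Polynomial Finset
open scoped BigOperators

noncomputable section

section Line

open Literature.Analysis.Quadrature

variable (p : ℕ) [Fact p.Prime]

/-- A polynomial supported in `S ⊆ [0,p)`, read modulo `p`, vanishes off the image of `S` in `ℤ/p`. [folklore] -/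
theorem coeff_val_eq_zero_of_notMem_image (S : Finset ℕ) (w : ℂ[X]) (hw : w.support ⊆ S) (x : ZMod p)
    (hx : x ∉ S.image (fun s : ℕ => (s : ZMod p))) : w.coeff x.val = 0 := by
  classical
  by_contra hne
  exact hx (Finset.mem_image.2 ⟨x.val, hw (mem_support_iff.2 hne), ZMod.natCast_zmod_val x⟩)

/-- **Wildness bound from anti-concentration + bounded sum multiplicity.**  `S ⊆ [0,p)` with sum multiplicity
`≤ g` modulo `p` and the anti-concentration floor `e₁ ∈ (0,1)` at a density `σ` with `√(gσ) ≤ 1/2`; then for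
`supp a, supp b ⊆ S`, `deg F < p`, `X^p − 1 ∣ a·b − F`, `|F_n| ≤ M`:
`(e₁/2)·(Σ_{s∈S}|a_s|²)(Σ_{s∈S}|b_s|²) ≤ #S²·M²`. [folklore] -/
theorem norm_mul_le_of_antiConcentration (S : Finset ℕ) (hS : ∀ a ∈ S, a < p) (g : ℕ)
    (hg : ∀ r : ZMod p, ((S.image (fun s : ℕ => (s : ZMod p))).filter
      (fun j => r - j ∈ S.image (fun s : ℕ => (s : ZMod p)))).card ≤ g)
    (σ e₁ : ℝ) (he₁ : 0 < e₁) (he₁1 : e₁ < 1) (hσ : Real.sqrt (g * σ) ≤ 1 / 2)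
    (hanti : ∀ w : ℂ[X], w.support ⊆ S → ∀ B : Finset (ZMod p), σ * p ≤ B.card →
      e₁ * ∑ k, ‖ZMod.dft (fun x : ZMod p => w.coeff x.val) k‖ ^ 2 ≤
        ∑ k ∈ B, ‖ZMod.dft (fun x : ZMod p => w.coeff x.val) k‖ ^ 2)
    (a b F : ℂ[X]) (ha : a.support ⊆ S) (hb : b.support ⊆ S) (M : ℝ) (hF : F.natDegree < p)
    (hdvd : (X : ℂ[X]) ^ p - 1 ∣ a * b - F) (hM : ∀ n, ‖F.coeff n‖ ≤ M) :
    e₁ / 2 * ((∑ s ∈ S, ‖a.coeff s‖ ^ 2) * (∑ s ∈ S, ‖b.coeff s‖ ^ 2)) ≤ (S.card : ℝ) ^ 2 * M ^ 2 := by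
  classical
  have hp : NeZero p := ⟨(Fact.out : p.Prime).ne_zero⟩
  set u : ZMod p → ℂ := fun x => a.coeff x.val with hudef
  set v : ZMod p → ℂ := fun x => b.coeff x.val with hvdef
  set T' : Finset (ZMod p) := S.image (fun s : ℕ => (s : ZMod p)) with hT'def
  -- concentration floor `1/2` for `v` at density `1 − σ` (Λ(4) from sum multiplicity)
  have hvT : ∀ j, j ∉ T' → v j = 0 := fun j hj => coeff_val_eq_zero_of_notMem_image p S b hb j hj
  have hv : ∀ B : Finset (ZMod p), (1 - σ) * p ≤ B.card →
      (1 / 2) * ∑ k, ‖ZMod.dft v k‖ ^ 2 ≤ ∑ k ∈ B, ‖ZMod.dft v k‖ ^ 2 := by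
    intro B hB
    have h := dft_energy_floor_of_sumMultiplicity T' g v hvT hg σ B hB
    have hT0 : 0 ≤ ∑ k, ‖ZMod.dft v k‖ ^ 2 := Finset.sum_nonneg fun k _ => sq_nonneg _
    have : (1 / 2 : ℝ) ≤ 1 - Real.sqrt (g * σ) := by linarith
    exact (mul_le_mul_of_nonneg_right this hT0).trans h
  -- two floors ⇒ `e₁ (1/2) ‖u‖² ‖v‖² ≤ ‖u ⋆ v‖²`
  have hcore := conv_energy_ge_of_spectralFloors σ e₁ (1 / 2) he₁.le he₁1 (by norm_num) u v (hanti a ha) hv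
  rw [hudef, hvdef, sum_zmod_norm_sq_eq p S hS a ha, sum_zmod_norm_sq_eq p S hS b hb] at hcore
  -- the convolution is the pattern: bounded by `M`, vanishing off `S + S mod p`
  have hconv : ∀ n : ZMod p, cyclicConv u v n = F.coeff n.val := fun n => by
    rw [coeff_mul_eq_cyclicConv p a b F (fun s hs => hS s (ha hs)) (fun t ht => hS t (hb ht)) hF hdvd n]
    simp only [cyclicConv, hudef, hvdef]
  set T : Finset (ZMod p) := (S ×ˢ S).image (fun ab : ℕ × ℕ => ((ab.1 + ab.2 : ℕ) : ZMod p)) with hTdef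
  have hT : ∀ n, n ∉ T → cyclicConv u v n = 0 := by
    intro n hn
    unfold cyclicConv
    refine Finset.sum_eq_zero fun x _ => ?_
    by_cases hx : x.val ∈ S
    · by_cases hy : (n - x).val ∈ S
      · exfalso
        refine hn (Finset.mem_image.2 ⟨(x.val, (n - x).val), Finset.mem_product.2 ⟨hx, hy⟩, ?_⟩)
        push_cast
        rw [ZMod.natCast_zmod_val, ZMod.natCast_zmod_val]; ring
      · have : b.coeff (n - x).val = 0 := notMem_support_iff.1 fun h => hy (hb h)
        simp [hvdef, this]
    · have : a.coeff x.val = 0 := notMem_support_iff.1 fun h => hx (ha h)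
      simp [hudef, this]
  have hTcard : (T.card : ℝ) ≤ (S.card : ℝ) ^ 2 := by
    have h1 : T.card ≤ (S ×ˢ S).card := Finset.card_image_le
    rw [Finset.card_product] at h1
    exact_mod_cast (by nlinarith [h1] : T.card ≤ S.card ^ 2)
  have hsumconv : ∑ n, ‖cyclicConv u v n‖ ^ 2 ≤ (T.card : ℝ) * M ^ 2 := by
    have hsplit : ∑ n, ‖cyclicConv u v n‖ ^ 2 = ∑ n ∈ T, ‖cyclicConv u v n‖ ^ 2 := by
      symm
      refine Finset.sum_subset (Finset.subset_univ T) fun n _ hn => ?_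
      rw [hT n hn, norm_zero]; ring
    rw [hsplit]
    calc ∑ n ∈ T, ‖cyclicConv u v n‖ ^ 2 ≤ ∑ _n ∈ T, M ^ 2 :=
          Finset.sum_le_sum fun n _ => by
            rw [hconv n]; exact pow_le_pow_left₀ (norm_nonneg _) (hM _) 2
      _ = (T.card : ℝ) * M ^ 2 := by rw [Finset.sum_const, nsmul_eq_mul]
  calc e₁ / 2 * ((∑ s ∈ S, ‖a.coeff s‖ ^ 2) * (∑ s ∈ S, ‖b.coeff s‖ ^ 2))
      = e₁ * (1 / 2) * (∑ s ∈ S, ‖a.coeff s‖ ^ 2) * (∑ s ∈ S, ‖b.coeff s‖ ^ 2) := by ring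
    _ ≤ ∑ n, ‖cyclicConv u v n‖ ^ 2 := hcore
    _ ≤ (T.card : ℝ) * M ^ 2 := hsumconv
    _ ≤ (S.card : ℝ) ^ 2 * M ^ 2 := mul_le_mul_of_nonneg_right hTcard (sq_nonneg _)

/-- **`stub_tameOperator` at rank 2 from small-density anti-concentration (exponent 1, constant `2/e₁`).**
Let `S ⊆ [0,p)` have sum multiplicity `≤ g` modulo `p` and the anti-concentration floor `e₁ ∈ (0,1)` at a density
`σ` with `√(gσ) ≤ 1/2` (hypotheses `hg`, `hanti`, as in `norm_mul_le_of_antiConcentration`).  For every pair of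
weighted squares `(c_i, w_i)_{i<2}` supported in `S` whose cyclic pattern `F` (`deg F < p`,
`X^p − 1 ∣ c₀w₀² + c₁w₁² − F`) has coefficients of modulus `≤ M`, there are weighted squares supported in `S`
with the same cyclic pattern and total mass `≤ (2#S/e₁)·M`.  Conditional rung: the anti-concentration floor is
the open input (census §6 (W5a)). [folklore] -/
theorem tameOperator_rank_two_of_antiConcentration (S : Finset ℕ) (hS : ∀ a ∈ S, a < p) (g : ℕ)
    (hg : ∀ r : ZMod p, ((S.image (fun s : ℕ => (s : ZMod p))).filter
      (fun j => r - j ∈ S.image (fun s : ℕ => (s : ZMod p)))).card ≤ g)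
    (σ e₁ : ℝ) (he₁ : 0 < e₁) (he₁1 : e₁ < 1) (hσ : Real.sqrt (g * σ) ≤ 1 / 2)
    (hanti : ∀ w : ℂ[X], w.support ⊆ S → ∀ B : Finset (ZMod p), σ * p ≤ B.card →
      e₁ * ∑ k, ‖ZMod.dft (fun x : ZMod p => w.coeff x.val) k‖ ^ 2 ≤
        ∑ k ∈ B, ‖ZMod.dft (fun x : ZMod p => w.coeff x.val) k‖ ^ 2)
    (c : Fin 2 → ℂ) (w : Fin 2 → ℂ[X]) (hw : ∀ i, (w i).support ⊆ S)
    (F : ℂ[X]) (M : ℝ) (hF : F.natDegree < p)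
    (hdvd : (X : ℂ[X]) ^ p - 1 ∣ (∑ i, C (c i) * w i ^ 2) - F) (hM : ∀ n, ‖F.coeff n‖ ≤ M) :
    ∃ (s' : ℕ) (c' : Fin s' → ℂ) (w' : Fin s' → ℂ[X]), (∀ j, (w' j).support ⊆ S) ∧
      ((X : ℂ[X]) ^ p - 1 ∣ (∑ j, C (c' j) * w' j ^ 2) - F) ∧
      (∑ j, sqMass (c' j) (w' j)) ≤ 2 * (S.card : ℝ) / e₁ * M := by
  classical
  have hM0 : 0 ≤ M := (norm_nonneg _).trans (hM 0)
  -- square roots of the weights and the product form (as in `tameOperator_rank_two_of_sidon`)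
  obtain ⟨γ0, hγ0⟩ : ∃ γ : ℂ, γ ^ 2 = c 0 := ⟨c 0 ^ ((2 : ℂ)⁻¹), Complex.cpow_nat_inv_pow (c 0) two_ne_zero⟩
  obtain ⟨γ1, hγ1⟩ : ∃ γ : ℂ, γ ^ 2 = c 1 := ⟨c 1 ^ ((2 : ℂ)⁻¹), Complex.cpow_nat_inv_pow (c 1) two_ne_zero⟩
  set a : ℂ[X] := C γ0 * w 0 + C (Complex.I * γ1) * w 1 with hadef
  set b : ℂ[X] := C γ0 * w 0 + C (-(Complex.I * γ1)) * w 1 with hbdef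
  have ha : a.support ⊆ S := support_lin_subset _ _ _ _ (hw 0) (hw 1)
  have hb : b.support ⊆ S := support_lin_subset _ _ _ _ (hw 0) (hw 1)
  have hab : a * b = ∑ i, C (c i) * w i ^ 2 := by
    rw [Fin.sum_univ_two, ← hγ0, ← hγ1, map_pow, map_pow, hadef, hbdef, map_neg, map_mul]
    have hI : (C Complex.I : ℂ[X]) ^ 2 = -1 := by rw [← map_pow, Complex.I_sq, map_neg, map_one]
    linear_combination (-(C γ1 * w 1) ^ 2) * hI
  have hdvd' : (X : ℂ[X]) ^ p - 1 ∣ a * b - F := by rw [hab]; exact hdvd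
  by_cases hF0 : F = 0
  · refine ⟨0, Fin.elim0, Fin.elim0, fun j => Fin.elim0 j, ?_, ?_⟩
    · rw [hF0]; simp
    · simp only [Finset.univ_eq_empty, Finset.sum_empty]; positivity
  set α : ℝ := ∑ s ∈ S, ‖a.coeff s‖ ^ 2 with hαdef
  set β : ℝ := ∑ s ∈ S, ‖b.coeff s‖ ^ 2 with hβdef
  have hα0 : 0 ≤ α := Finset.sum_nonneg fun s _ => sq_nonneg _
  have hβ0 : 0 ≤ β := Finset.sum_nonneg fun s _ => sq_nonneg _
  have hαpos : 0 < α := by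
    rcases hα0.lt_or_eq with h | h
    · exact h
    · exfalso
      have hzero : ∀ s ∈ S, a.coeff s = 0 := by
        intro s hs
        have := (Finset.sum_eq_zero_iff_of_nonneg (fun s _ => sq_nonneg ‖a.coeff s‖)).1 h.symm s hs
        exact norm_eq_zero.1 ((pow_eq_zero_iff two_ne_zero).1 this)
      have ha0 : a = 0 := by
        ext s
        by_cases hs : s ∈ a.support
        · exact hzero s (ha hs)
        · exact notMem_support_iff.1 hs
      apply hF0
      refine eq_zero_of_dvd_of_lt p hF ?_
      have : (X : ℂ[X]) ^ p - 1 ∣ -(a * b - F) := dvd_neg.2 hdvd'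
      rwa [ha0, zero_mul, zero_sub, neg_neg] at this
  have hMpos : 0 < M := by
    obtain ⟨n, hn⟩ : ∃ n, F.coeff n ≠ 0 := by
      by_contra hall
      push Not at hall
      exact hF0 (Polynomial.ext fun n => by rw [hall n, coeff_zero])
    exact lt_of_lt_of_le (norm_pos_iff.2 hn) (hM n)
  have hSpos : 0 < (S.card : ℝ) := by
    have : S.Nonempty := by
      by_contra hS'
      rw [Finset.not_nonempty_iff_eq_empty] at hS'
      rw [hαdef, hS', Finset.sum_empty] at hαpos
      exact lt_irrefl _ hαpos
    exact_mod_cast this.card_pos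
  -- the floors: `(e₁/2) α β ≤ #S² M²`
  have hαβ := norm_mul_le_of_antiConcentration p S hS g hg σ e₁ he₁ he₁1 hσ hanti a b F ha hb M hF hdvd' hM
  -- balance `t² = T := L/α` with `L = 2 #S M / e₁`
  set L : ℝ := 2 * (S.card : ℝ) * M / e₁ with hLdef
  have hLpos : 0 < L := by positivity
  set T : ℝ := L / α with hTdef
  have hTpos : 0 < T := by positivity
  obtain ⟨c', w', hsupp', hdvd'', hmass⟩ :=
    exists_squares_of_mul p S a b F ha hb hdvd' (Real.sqrt T) (Real.sqrt_pos.2 hTpos)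
  refine ⟨2, c', w', hsupp', hdvd'', hmass.trans ?_⟩
  rw [Real.sq_sqrt hTpos.le]
  have hTα : T * α = L := by rw [hTdef]; field_simp
  -- `β / T = αβ / L ≤ (2 #S² M² / e₁) / (2 #S M / e₁) = #S M ≤ L`
  have hαβ' : α * β ≤ 2 * (S.card : ℝ) ^ 2 * M ^ 2 / e₁ := by
    rw [le_div_iff₀ he₁]
    have := hαβ
    rw [← hαdef, ← hβdef] at this
    nlinarith
  have hβT : β / T ≤ (S.card : ℝ) * M := by
    rw [div_le_iff₀ hTpos, hTdef]
    rw [show (S.card : ℝ) * M * (L / α) = ((S.card : ℝ) * M * L) / α by ring, le_div_iff₀ hαpos]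
    have hL : (S.card : ℝ) * M * L = 2 * (S.card : ℝ) ^ 2 * M ^ 2 / e₁ := by rw [hLdef]; ring
    rw [hL]
    linarith [hαβ']
  have hSM : (S.card : ℝ) * M ≤ L := by
    rw [hLdef, le_div_iff₀ he₁]
    have hSM0 : 0 < (S.card : ℝ) * M := mul_pos hSpos hMpos
    have h1 : (S.card : ℝ) * M * e₁ < (S.card : ℝ) * M * 1 := mul_lt_mul_of_pos_left he₁1 hSM0
    linarith
  rw [← hαdef, ← hβdef, hTα]
  have : 2 * (S.card : ℝ) / e₁ * M = L := by rw [hLdef]; ring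
  rw [this]
  linarith [hβT, hSM]

end Line

end

end Summit.ValiantsHypothesis.ValiantsHypothesis.Theorems.FeketeSOSHardPaleyRIP
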